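import Mathlib.Analysis.SpecialFunctions.BinaryEntropy
import Mathlib.Analysis.SpecialFunctions.Pow.Real
import Mathlib.Analysis.SpecialFunctions.Log.Base
import Literature.Computability.AlgebraicComplexity.TripartitionTensor
import Literature.Computability.AlgebraicComplexity.AsymptoticSpectrum
import Literature.Computability.AlgebraicComplexity.StandardFamilies
import HarnessLib

/-!
# The tensor-rank exponent `σ(P_ℕ)` of balanced tripartitioning and circuits for the permanent
# (Björklund–Kaski–Koana–Nederlof 2025)

Topic `Computability/AlgebraicComplexity`; cite item wi-37901 (planner of route
`ValiantsHypothesis/RyserTripartition`, negation-construct lens). Named facts from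

A. Björklund, P. Kaski, T. Koana, J. Nederlof, *Kronecker scaling of tensors with applications to
arithmetic circuits and algorithms*, ICALP 2025 / arXiv:2504.05772 [BjorklundEtAl2025]
(held text `paper:arxiv-2504.05772`),

over the tree's vocabulary: Pratt's balanced tripartitioning tensors
`tripartitionTensor K n = P_n = ∑_{A ⊔ B ⊔ C = [3n]} x_A y_B z_C` on
`TripartitionIndex n = binom([3n], n)` (`TripartitionTensor.lean`; BKKN eq. (3)), tensor rank
`tensorRank` (`MatrixMultiplicationExponent.lean`), asymptotic rank `asymptoticRank`
(`AsymptoticSpectrum.lean`), the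
fan-in-two circuit complexity `complexity` (`ArithCircuit.lean`) and the generic permanent `perPoly`
(`StandardFamilies.lean`).

## What is printed (arXiv v1, pp. 3–5, 10)

* Eq. (4), p. 3: "for a sequence `T_ℕ` consisting of three-tensors `T_n` of shape `s_n × s_n × s_n`
  for `n ∈ ℕ`, define the exponent `σ(T_ℕ) = inf {σ > 0 : R(T_n) ≤ s_n^{σ+o(1)}}`." For `P_ℕ`,
  `s_n = binom(3n, n)`; "the exponent `σ(P_ℕ)` satisfies `1 ≤ σ(P_ℕ) ≤ H(1/3)⁻¹`, where
  `H(λ) = −λ log₂ λ − (1 − λ) log₂(1 − λ)` is the binary entropy function."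
* **Theorem 1.3** (p. 4). "For all `ϵ > 0` there exists an algorithm that given `n` as input runs in
  time `O(2^{H(1/3)(σ(P_ℕ)+ϵ)n})` and outputs an arithmetic circuit of size
  `O(2^{H(1/3)(σ(P_ℕ)+ϵ)n})` for the `n × n` permanent." (§2.2: circuits over a field `F`, internal
  nodes `+`/`×` of unbounded fan-in, size = number of arcs.)
* **Theorem 3.3** (p. 10). "`σ(P_ℕ) = inf {σ > 0 : R(P_n) ≤ binom(3n,n)^{σ+o(1)}}
  = inf {σ > 0 : R̃(P_n) ≤ binom(3n,n)^{σ+o(1)}}`."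
* §1.3 (p. 5). "The balanced tripartitioning tensors `P_n` are known to be both tight and concise,
  which via the asymptotic scaling identity (cf. Theorem 3.3) immediately translates to
  `σ(P_ℕ) = 1`. Thus, under Strassen's asymptotic rank conjecture, Theorem 1.3 yields uniform
  arithmetic circuits for the permanent that are exponentially smaller than Ryser's formula. …
  Theorem 1.3 also implies that strong exponential lower bounds for the arithmetic complexity of
  the permanent disprove the asymptotic rank conjecture." (Tightness and conciseness of `P_n`:
  [Pratt2024SCC], Prop. 2.1.)

## Lean rendering

* `rankExponent R s = inf {σ > 0 | ∀ δ > 0, ∃ n₀, ∀ n ≥ n₀, R n ≤ (s n)^{σ+δ}}` renders eq. (4):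
  for `s_n ≥ 1` a bound `R(T_n) ≤ s_n^{σ+o(1)}` gives, for every `δ > 0`, `R(T_n) ≤ s_n^{σ+δ}`
  eventually, and conversely such eventual bounds for all `δ` put every `σ + δ'` (`δ' > 0`) in the
  printed set (absorb the finitely many small `n`, where `s_n > 1` for `n ≥ 1` and `R(P_0) ≤ 1`,
  into the `o(1)`); the two infima agree. `Real.sInf` has junk value `0` on an empty or unbounded
  set; here the set contains `2` (rank ≤ product of two side lengths) and is bounded below by `0`.
* `tripartitionRankExponent K = σ(P_ℕ)` over the field `K` (tensor rank is field dependent) and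
  `tripartitionAsymptoticRankExponent K` (the right-hand side of (14)).
* `log2BinEntropyThird = H(1/3)` IN BITS: Mathlib's `Real.binEntropy` is in nats, so
  `H(1/3) = binEntropy (1/3) / log 2 = log₂ 3 − 2/3 ≈ 0.91830` (and `2^{H(1/3) n} = (27/4)^{n/3}`).
* Theorem 1.3 is recorded in its NON-UNIFORM consequence over `F = ℂ` (the field of the summit
  `ValiantsHypothesis` and of the consuming route), `bkkn2025_thm_1_3`:
  `∀ ε > 0, ∃ C, ∀ n, L(per_n) ≤ C · 2^{H(1/3)(σ(P_ℕ)+ε) n}` with the tree's fan-in-two `complexity`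
  — a circuit with `a` arcs and unbounded fan-in is a fan-in-two circuit with `≤ a` gates, and
  `O(·)` over all `n ≥ n₀` becomes `∃ C, ∀ n` since every `per_n` has SOME circuit
  (`ArithCircuit.exists_computes`). Weaker than print (uniformity and running time dropped).
* Theorem 3.3 over `ℂ`: `bkkn2025_thm_3_3`.
* PROVED here: (a) `tripartitionAsymptoticRankExponent_eq_one` — if `R̃(P_n) = binom(3n,n)` for
  `n ≥ 1` (which is what Strassen's asymptotic rank conjecture, tree
  `StrassenAsymptoticRankConjecture` over `Fin m` formats, gives for the tight and concise `P_n`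
  after reindexing along `TripartitionIndex n ≃ Fin binom(3n,n)` — that step is left to the
  Summits side, conjectures not being Literature) then the asymptotic-rank exponent is `1`, hence
  with Thm. 3.3 `σ(P_ℕ) = 1` (`tripartitionRankExponent_eq_one_of_thm_3_3`); (b) from Thm. 1.3 and
  `σ(P_ℕ) = 1`: permanent circuits of size `C · 2^{c n}` with `c < 1`
  (`exists_subRyser_of_sigma_eq_one`, via Mathlib's `Real.binEntropy_lt_log_two`: `H(1/3) < 1`),
  so the Ryser-optimality statement `∀ ε > 0, ∃ n₀, ∀ n ≥ n₀, 2^{(1−ε)n} ≤ L(per_n)` (the target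
  `RyserOptimal` of route `ValiantsHypothesis/RyserTripartition`, inlined verbatim) FAILS
  (`not_ryserOptimal_of_sigma_eq_one`, `not_ryserOptimal_of_minimalAsymptoticRank`) — the printed
  "strong exponential lower bounds for the arithmetic complexity of the permanent disprove the
  asymptotic rank conjecture".

What is NOT here: Theorems 1.1/1.2/3.2 (Kronecker scaling, the explicit decomposition), the
hafnian and set-partition applications (Thms. 1.4–1.5), uniformity/running times, the bounds
`1 ≤ σ(P_ℕ) ≤ H(1/3)⁻¹` (footnote 3), tightness/conciseness of `P_n` ([Pratt2024SCC] Prop. 2.1)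
and the reindexing invariance of `asymptoticRank` as Lean theorems.

## References

* [BjorklundEtAl2025] arXiv:2504.05772, eq. (3)–(4) p. 3, Thm. 1.3 p. 4, §1.3 p. 5, §2.2 p. 7,
  Thm. 3.3 p. 10, §5.3 Lemma 5.3.
* [Pratt2024SCC] K. Pratt, STOC 2024, arXiv:2311.02774, Def. 1.4, Prop. 2.1.
* [ConnerGesmundoLandsbergVenturaWang2020] CGLVW, Conj. 1.4 (Strassen's asymptotic rank conjecture).
-/

noncomputable section

namespace Literature.Computability.AlgebraicComplexity

open Real

/-! ### Exponents of cubic tensor sequences (BKKN eq. (4)) -/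

/-- The **exponent of a sequence of cubic three-tensors** with rank-like invariant `R n` and side
length `s n` (BKKN eq. (4): `σ(T_ℕ) = inf {σ > 0 : R(T_n) ≤ s_n^{σ+o(1)}}`), rendered with the
`o(1)` unwound: `σ` qualifies iff for every `δ > 0`, `R n ≤ (s n)^{σ+δ}` for all large `n`.
`Real.sInf` (junk `0` on `∅`). [cite: BjorklundEtAl2025, eq. (4) (p. 3)] -/
def rankExponent (R : ℕ → ℝ) (s : ℕ → ℕ) : ℝ :=
  sInf {σ : ℝ | 0 < σ ∧ ∀ δ : ℝ, 0 < δ → ∃ n₀ : ℕ, ∀ n : ℕ, n₀ ≤ n → R n ≤ (s n : ℝ) ^ (σ + δ)}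

/-- **`σ(P_ℕ)`**, the tensor-rank exponent of the balanced tripartitioning sequence over the field
`K`: `inf {σ > 0 : R(P_n) ≤ binom(3n,n)^{σ+o(1)}}` (BKKN eq. (4) for the sequence (3); `P_n` has
shape `binom(3n,n)³`). [cite: BjorklundEtAl2025, eq. (3)–(4) (p. 3)] -/
def tripartitionRankExponent (K : Type) [Field K] : ℝ :=
  rankExponent (fun n => (tensorRank (tripartitionTensor K n) : ℝ)) (fun n => (3 * n).choose n)

/-- The asymptotic-rank exponent of the balanced tripartitioning sequence over `K`:
`inf {σ > 0 : R̃(P_n) ≤ binom(3n,n)^{σ+o(1)}}` (right-hand side of BKKN (14)).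
[cite: BjorklundEtAl2025, Thm. 3.3 (eq. (14), p. 10)] -/
def tripartitionAsymptoticRankExponent (K : Type) [Field K] : ℝ :=
  rankExponent (fun n => asymptoticRank (tripartitionTensor K n)) (fun n => (3 * n).choose n)

/-- The binary entropy at `1/3` IN BITS, `H(1/3) = −(1/3) log₂(1/3) − (2/3) log₂(2/3)
= log₂ 3 − 2/3 ≈ 0.91830` (Mathlib's `Real.binEntropy` is in nats). [folklore] -/
def log2BinEntropyThird : ℝ := binEntropy (1 / 3) / log 2

/-! ### The named facts -/

/-- **BKKN 2025, Theorem 1.3 (non-uniform form, over `ℂ`).** For every `ε > 0` there is `C` with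
`L(per_n) ≤ C · 2^{H(1/3)(σ(P_ℕ)+ε) n}` for all `n`, `L` the fan-in-two circuit complexity of the
generic `n × n` permanent over `ℂ` and `σ(P_ℕ) = tripartitionRankExponent ℂ`. Printed: "For all
`ϵ > 0` there exists an algorithm that given `n` as input runs in time `O(2^{H(1/3)(σ(P_ℕ)+ϵ)n})`
and outputs an arithmetic circuit of size `O(2^{H(1/3)(σ(P_ℕ)+ϵ)n})` for the `n × n` permanent"
(size = arcs, unbounded fan-in, §2.2 — at least the fan-in-two gate count; uniformity dropped;
`O` over large `n` ⇒ `∃ C ∀ n` as every `per_n` has a circuit). A named fact, not proved here.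
[cite: BjorklundEtAl2025, Thm. 1.3 (p. 4) with §2.2 and Lemma 5.3] -/
def bkkn2025_thm_1_3 : Prop :=
  ∀ ε : ℝ, 0 < ε → ∃ C : ℝ, ∀ n : ℕ,
    (complexity (perPoly (Fin n) ℂ) : ℝ) ≤
      C * (2 : ℝ) ^ (log2BinEntropyThird * (tripartitionRankExponent ℂ + ε) * n)

/-- **BKKN 2025, Theorem 3.3 (asymptotic scaling), over `ℂ`.** The tensor-rank and asymptotic-rank
exponents of the balanced tripartitioning sequence coincide:
`σ(P_ℕ) = inf {σ > 0 : R(P_n) ≤ binom(3n,n)^{σ+o(1)}}`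
`= inf {σ > 0 : R̃(P_n) ≤ binom(3n,n)^{σ+o(1)}}` (a consequence of the Kronecker scaling
Theorem 3.2). A named fact, not proved here.
[cite: BjorklundEtAl2025, Thm. 3.3 (p. 10)] -/
def bkkn2025_thm_3_3 : Prop :=
  tripartitionRankExponent ℂ = tripartitionAsymptoticRankExponent ℂ

/-! ### Consequences proved here -/

section Proofs

variable {R : ℕ → ℝ} {s : ℕ → ℕ}

/-- The defining set of `rankExponent` is bounded below (by `0`). [folklore] -/
theorem bddBelow_rankExponentSet :
    BddBelow {σ : ℝ | 0 < σ ∧ ∀ δ : ℝ, 0 < δ → ∃ n₀ : ℕ, ∀ n : ℕ, n₀ ≤ n →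
      R n ≤ (s n : ℝ) ^ (σ + δ)} :=
  ⟨0, fun _ hσ => hσ.1.le⟩

/-- An admissible exponent bounds `rankExponent` from above. [folklore] -/
theorem rankExponent_le {σ : ℝ} (hσ : 0 < σ)
    (h : ∀ δ : ℝ, 0 < δ → ∃ n₀ : ℕ, ∀ n : ℕ, n₀ ≤ n → R n ≤ (s n : ℝ) ^ (σ + δ)) :
    rankExponent R s ≤ σ :=
  csInf_le bddBelow_rankExponentSet ⟨hσ, h⟩

/-- A lower bound for every admissible exponent bounds `rankExponent` from below, provided some
exponent is admissible. [folklore] -/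
theorem le_rankExponent {τ σ₀ : ℝ} (hσ₀ : 0 < σ₀)
    (h₀ : ∀ δ : ℝ, 0 < δ → ∃ n₀ : ℕ, ∀ n : ℕ, n₀ ≤ n → R n ≤ (s n : ℝ) ^ (σ₀ + δ))
    (h : ∀ σ : ℝ, 0 < σ →
      (∀ δ : ℝ, 0 < δ → ∃ n₀ : ℕ, ∀ n : ℕ, n₀ ≤ n → R n ≤ (s n : ℝ) ^ (σ + δ)) → τ ≤ σ) :
    τ ≤ rankExponent R s :=
  le_csInf ⟨σ₀, hσ₀, h₀⟩ fun _ hσ => h _ hσ.1 hσ.2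

/-- `binom(3n, n) ≥ 2` for `n ≥ 1`. [folklore] -/
theorem two_le_choose_three_mul {n : ℕ} (hn : 1 ≤ n) : 2 ≤ (3 * n).choose n := by
  obtain ⟨k, rfl⟩ : ∃ k, n = k + 1 := ⟨n - 1, by omega⟩
  rw [show 3 * (k + 1) = (3 * k + 2) + 1 by ring, Nat.choose_succ_succ']
  have h1 : 1 ≤ (3 * k + 2).choose k := Nat.choose_pos (by omega)
  have h2 : 1 ≤ (3 * k + 2).choose (k + 1) := Nat.choose_pos (by omega)
  omega

/-- **Minimal asymptotic rank along `P_ℕ` forces asymptotic-rank exponent `1`** (the §1.3 step: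
`R̃(P_n) = binom(3n,n)` for `n ≥ 1` ⇒ the right-hand infimum of (14) is `1`; `≤ 1` as `σ = 1`
qualifies, `≥ 1` as `binom(3n,n) ≥ 2`). The hypothesis is what the asymptotic rank statement
ARC (CGLVW Conj. 1.4, tree `StrassenAsymptoticRankConjecture`, after reindexing
`TripartitionIndex n ≃ Fin binom(3n,n)`) yields for the tight and concise tensors `P_n`
([Pratt2024SCC] Prop. 2.1). Proved, any field. [cite: BjorklundEtAl2025, §1.3 (p. 5)] -/
theorem tripartitionAsymptoticRankExponent_eq_one {K : Type} [Field K]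
    (hmin : ∀ n : ℕ, 1 ≤ n →
      asymptoticRank (tripartitionTensor K n) = (((3 * n).choose n : ℕ) : ℝ)) :
    tripartitionAsymptoticRankExponent K = 1 := by
  -- `σ = 1` is admissible
  have hadm : ∀ δ : ℝ, 0 < δ → ∃ n₀ : ℕ, ∀ n : ℕ, n₀ ≤ n →
      asymptoticRank (tripartitionTensor K n) ≤ (((3 * n).choose n : ℕ) : ℝ) ^ ((1 : ℝ) + δ) := by
    intro δ hδ
    refine ⟨1, fun n hn => ?_⟩
    rw [hmin n hn]
    have h1 : (1 : ℝ) ≤ (((3 * n).choose n : ℕ) : ℝ) := by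
      exact_mod_cast (Nat.choose_pos (by omega) : 1 ≤ (3 * n).choose n)
    exact Real.self_le_rpow_of_one_le h1 (by linarith)
  refine le_antisymm (rankExponent_le one_pos hadm) (le_rankExponent one_pos hadm ?_)
  -- every admissible `σ` is `≥ 1`
  intro σ hσ h
  by_contra hlt
  push Not at hlt
  obtain ⟨n₀, hn₀⟩ := h ((1 - σ) / 2) (by linarith)
  set n := max n₀ 1 with hn
  have hn1 : 1 ≤ n := le_max_right _ _
  have key := hn₀ n (le_max_left _ _)
  rw [hmin n hn1] at key
  have h2 : (2 : ℝ) ≤ (((3 * n).choose n : ℕ) : ℝ) := by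
    exact_mod_cast two_le_choose_three_mul hn1
  have hlt' : (((3 * n).choose n : ℕ) : ℝ) ^ (σ + (1 - σ) / 2) <
      (((3 * n).choose n : ℕ) : ℝ) ^ (1 : ℝ) :=
    Real.rpow_lt_rpow_of_exponent_lt (by linarith) (by linarith)
  rw [Real.rpow_one] at hlt'
  exact absurd key (not_le.mpr hlt')

/-- With Theorem 3.3: minimal asymptotic rank along `P_ℕ` (over `ℂ`) gives `σ(P_ℕ) = 1`.
[cite: BjorklundEtAl2025, §1.3 (p. 5) with Thm. 3.3] -/
theorem tripartitionRankExponent_eq_one_of_thm_3_3 (h33 : bkkn2025_thm_3_3)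
    (hmin : ∀ n : ℕ, 1 ≤ n →
      asymptoticRank (tripartitionTensor ℂ n) = (((3 * n).choose n : ℕ) : ℝ)) :
    tripartitionRankExponent ℂ = 1 :=
  h33.trans (tripartitionAsymptoticRankExponent_eq_one hmin)

/-- `H(1/3) < 1` bit (`binEntropy (1/3) < log 2`, Mathlib's `binEntropy_lt_log_two`). [folklore] -/
theorem log2BinEntropyThird_lt_one : log2BinEntropyThird < 1 := by
  have hlog : 0 < log 2 := log_pos one_lt_two
  have h : binEntropy (1 / 3 : ℝ) < log 2 := binEntropy_lt_log_two.2 (by norm_num)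
  unfold log2BinEntropyThird
  rwa [div_lt_one hlog]

/-- `0 < H(1/3)`. [folklore] -/
theorem log2BinEntropyThird_pos : 0 < log2BinEntropyThird := by
  have hlog : 0 < log 2 := log_pos one_lt_two
  unfold log2BinEntropyThird
  exact div_pos (binEntropy_pos (by norm_num) (by norm_num)) hlog

/-- If `σ(P_ℕ) = 1`, Theorem 1.3 gives permanent circuits of size `C · 2^{c n}` with `c < 1`
(`c = H(1/3)(1 + ε)` for small `ε`; "exponentially smaller than Ryser's formula").
[cite: BjorklundEtAl2025, §1.3 (p. 5)] -/
theorem exists_subRyser_of_sigma_eq_one (h13 : bkkn2025_thm_1_3)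
    (hσ : tripartitionRankExponent ℂ = 1) :
    ∃ c : ℝ, c < 1 ∧ ∃ C : ℝ, ∀ n : ℕ,
      (complexity (perPoly (Fin n) ℂ) : ℝ) ≤ C * (2 : ℝ) ^ (c * n) := by
  set H := log2BinEntropyThird with hH
  have hH1 : H < 1 := log2BinEntropyThird_lt_one
  have hH0 : 0 < H := log2BinEntropyThird_pos
  -- ε := (1 - H) / 2, c := H (1 + ε) ≤ H + ε < 1
  obtain ⟨C, hC⟩ := h13 ((1 - H) / 2) (by linarith)
  refine ⟨H * (1 + (1 - H) / 2), by nlinarith, C, fun n => ?_⟩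
  simpa [hσ] using hC n

/-- **`σ(P_ℕ) = 1` (e.g. under ARC) refutes Ryser-optimality of the permanent**: the statement
"for every `ε > 0` and all large `n`, `L(per_n) ≥ 2^{(1−ε)n}`" (the target `RyserOptimal` of route
`ValiantsHypothesis/RyserTripartition`, inlined verbatim) fails. Printed: "Theorem 1.3 also
implies that strong exponential lower bounds for the arithmetic complexity of the permanent
disprove the asymptotic rank" statement ARC. Proved from the named fact `bkkn2025_thm_1_3`.
[cite: BjorklundEtAl2025, §1.3 (p. 5)] -/
theorem not_ryserOptimal_of_sigma_eq_one (h13 : bkkn2025_thm_1_3)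
    (hσ : tripartitionRankExponent ℂ = 1) :
    ¬ (∀ ε : ℝ, 0 < ε → ∃ n₀ : ℕ, ∀ n ≥ n₀,
        (2 : ℝ) ^ ((1 - ε) * (n : ℝ)) ≤ (complexity (perPoly (Fin n) ℂ) : ℝ)) := by
  intro hR
  obtain ⟨c, hc1, C, hC⟩ := exists_subRyser_of_sigma_eq_one h13 hσ
  -- Ryser-optimality at ε := (1 - c)/2 against the upper bound C · 2^{c n}
  obtain ⟨n₀, hn₀⟩ := hR ((1 - c) / 2) (by linarith)
  have two_pos : (0 : ℝ) < 2 := two_pos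
  -- for n ≥ n₀: 2^{((1+c)/2) n} ≤ C 2^{c n}, i.e. 2^{((1-c)/2) n} ≤ C
  have key : ∀ n : ℕ, n₀ ≤ n → (2 : ℝ) ^ ((1 - c) / 2 * (n : ℝ)) ≤ C := by
    intro n hn
    have h := (hn₀ n hn).trans (hC n)
    have hsplit : (2 : ℝ) ^ ((1 - (1 - c) / 2) * (n : ℝ)) =
        (2 : ℝ) ^ ((1 - c) / 2 * (n : ℝ)) * (2 : ℝ) ^ (c * (n : ℝ)) := by
      rw [← rpow_add two_pos]; ring_nf
    rw [hsplit] at h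
    have hpos : 0 < (2 : ℝ) ^ (c * (n : ℝ)) := rpow_pos_of_pos two_pos _
    exact le_of_mul_le_mul_right h hpos
  -- but 2^{a n} is unbounded for a > 0
  have ha : 0 < (1 - c) / 2 := by linarith
  have hCpos : 0 < C := lt_of_lt_of_le (rpow_pos_of_pos two_pos _) (key n₀ le_rfl)
  obtain ⟨n, hn⟩ := exists_nat_ge (max (n₀ : ℝ) ((logb 2 C + 1) / ((1 - c) / 2)))
  have hn₀ : n₀ ≤ n := by exact_mod_cast (le_max_left _ _).trans hn
  have hn1 : (logb 2 C + 1) / ((1 - c) / 2) ≤ n := (le_max_right _ _).trans hn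
  have hexp : logb 2 C + 1 ≤ (1 - c) / 2 * (n : ℝ) := by
    rw [div_le_iff₀ ha] at hn1; linarith
  have hlt : C < (2 : ℝ) ^ ((1 - c) / 2 * (n : ℝ)) := by
    calc C = (2 : ℝ) ^ (logb 2 C) := (rpow_logb two_pos (by norm_num) hCpos).symm
      _ < (2 : ℝ) ^ (logb 2 C + 1) := rpow_lt_rpow_of_exponent_lt one_lt_two (by linarith)
      _ ≤ (2 : ℝ) ^ ((1 - c) / 2 * (n : ℝ)) := rpow_le_rpow_of_exponent_le one_le_two hexp
  exact absurd (key n hn₀) (not_le.mpr hlt)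

/-- The whole §1.3 chain: Theorem 1.3 + Theorem 3.3 + minimal asymptotic rank along `P_ℕ`
(the consequence of ARC for these tight, concise tensors) ⇒ Ryser is not optimal.
[cite: BjorklundEtAl2025, §1.3 (p. 5)] -/
theorem not_ryserOptimal_of_minimalAsymptoticRank (h13 : bkkn2025_thm_1_3)
    (h33 : bkkn2025_thm_3_3)
    (hmin : ∀ n : ℕ, 1 ≤ n →
      asymptoticRank (tripartitionTensor ℂ n) = (((3 * n).choose n : ℕ) : ℝ)) :
    ¬ (∀ ε : ℝ, 0 < ε → ∃ n₀ : ℕ, ∀ n ≥ n₀,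
        (2 : ℝ) ^ ((1 - ε) * (n : ℝ)) ≤ (complexity (perPoly (Fin n) ℂ) : ℝ)) :=
  not_ryserOptimal_of_sigma_eq_one h13 (tripartitionRankExponent_eq_one_of_thm_3_3 h33 hmin)

end Proofs

end Literature.Computability.AlgebraicComplexity

end
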